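import Literature.Geometry.DiscreteGeometry.SphericalExcessMonotone
import HarnessLib

/-!
# The angles of an isosceles contact spherical triangle (two sides `π/3`) from its base

Topic `Literature/Geometry/DiscreteGeometry`.  In Hales's proof of the Fejes Tóth kissing-twelve
conjecture (arXiv:1209.6043) the linear programs of Lemma 9 constrain the ANGLES of the faces of
the contact fan at each node: each angle of a contact triangle is `α₃ = arccos (1/3)`
(`angle_perpTo_eq_arccos_third`, `SphericalExcessMonotone.lean`), and the angle of a rhombus
(two contact triangles' worth: an isosceles contact triangle on each side of a long diagonal)
lies between `α₄` and `β₄` (Lemma 7).  For the fan-refined Delaunay triangulation the relevant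
object is the ISOSCELES CONTACT TRIANGLE: unit vectors `a, b, c` with `⟪a, b⟫ = ⟪a, c⟫ = 1/2`
(two sides of arclength `π/3` from the apex `a`) and base cosine `x = ⟪b, c⟫`.  This file
computes its angles (dihedral angles `∠(perpTo · ·, perpTo · ·)` as in `sphExcess`) from `x`:

* `cos_apexAngle_isosceles`: `cos ∠ₐ = (4x − 1)/3`; `apexAngle_isosceles_eq_arccos`:
  `∠ₐ = arccos ((4x − 1)/3)` — decreasing in `x`; at `x = 1/2` it is `α₃`, at `x = κ₀` Hales's
  `α₄`, at `x = 0` (square) `arccos (−1/3) = π − α₃`, at `x = −1/3` (flat rhombus) `2α₃`;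
* `cos_baseAngle_isosceles_mul`: `cos ∠_b · (√3/2 · ‖perpTo b c‖) = (1 − x)/2`
  (`‖perpTo b c‖ = √(1 − x²)`), and the squared form `cos_baseAngle_isosceles_sq_mul`:
  `cos² ∠_b · 3 (1 − x²) = (1 − x)²`, i.e. `cos² ∠_b = (1 − x)/(3 (1 + x))` for `x² < 1`;
  `baseAngle_isosceles_eq`: the two base angles are equal (`∠_b = ∠_c`);
  `cos_baseAngle_isosceles_pos`: the base angles are acute;
* monotone bounds for the linear programs: `arccos_le_apexAngle_isosceles` (`x ≤ t ⇒
  arccos ((4t−1)/3) ≤ ∠ₐ`), `apexAngle_isosceles_le_arccos` (`t ≤ x ⇒ ∠ₐ ≤ arccos ((4t−1)/3)`);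
* Part B: `cos_baseAngle_isosceles_eq_sqrt`, `baseAngle_isosceles_eq_arccos`
  (`∠_b = arccos √((1 − x)/(3 (1 + x)))`), `baseAngle_isosceles_le_arccos`,
  `arccos_le_baseAngle_isosceles` (the base angle increases with the base).

Everything is PROVED (any real inner product space); no named facts.

## References
* T. C. Hales, arXiv:1209.6043 (2012), Lemma 7 (the bounds `α₄ ≤ · ≤ β₄`) and the proof of
  Lemma 9 (constraints 2–4). [`Hales2012`]
-/

noncomputable section

namespace Literature.Geometry.DiscreteGeometry

open Real RealInnerProductSpace InnerProductGeometry

section Isosceles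

variable {F : Type*} [NormedAddCommGroup F] [InnerProductSpace ℝ F]
variable {a b c : F}

/-- The projections of the two equal sides at the apex have squared length `3/4`.
[folklore] -/
theorem norm_perpTo_sq_of_inner_eq_half (ha : ‖a‖ = 1) (hb : ‖b‖ = 1) (hab : ⟪a, b⟫ = 1 / 2) :
    ‖perpTo a b‖ ^ 2 = 3 / 4 := by
  rw [norm_perpTo_sq_of_norm_eq_one ha hb, hab]; norm_num

/-- … hence length `√3/2`. [folklore] -/
theorem norm_perpTo_of_inner_eq_half (ha : ‖a‖ = 1) (hb : ‖b‖ = 1) (hab : ⟪a, b⟫ = 1 / 2) :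
    ‖perpTo a b‖ = Real.sqrt 3 / 2 := by
  have h := norm_perpTo_sq_of_inner_eq_half ha hb hab
  have hnn : 0 ≤ ‖perpTo a b‖ := norm_nonneg _
  have h3 : Real.sqrt 3 / 2 = Real.sqrt (3 / 4) := by
    rw [show (3 : ℝ) / 4 = 3 / 2 ^ 2 by norm_num, Real.sqrt_div' _ (by norm_num : (0:ℝ) ≤ 2 ^ 2),
      Real.sqrt_sq (by norm_num : (0:ℝ) ≤ 2)]
  rw [h3, ← h, Real.sqrt_sq hnn]

/-- **The apex angle of an isosceles contact triangle**: for unit `a, b, c` with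
`⟪a, b⟫ = ⟪a, c⟫ = 1/2`, `cos ∠(perpTo a b, perpTo a c) = (4⟪b, c⟫ − 1)/3`.
[cite: Hales2012, Lemma 7 (α₄, β₄ as functions of the diagonal)] -/
theorem cos_apexAngle_isosceles (ha : ‖a‖ = 1) (hb : ‖b‖ = 1) (hc : ‖c‖ = 1)
    (hab : ⟪a, b⟫ = 1 / 2) (hac : ⟪a, c⟫ = 1 / 2) :
    Real.cos (angle (perpTo a b) (perpTo a c)) = (4 * ⟪b, c⟫ - 1) / 3 := by
  have hprod : ‖perpTo a b‖ * ‖perpTo a c‖ = 3 / 4 := by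
    rw [norm_perpTo_of_inner_eq_half ha hb hab, norm_perpTo_of_inner_eq_half ha hc hac]
    have h3 : Real.sqrt 3 * Real.sqrt 3 = 3 := Real.mul_self_sqrt (by norm_num)
    linear_combination h3 / 4
  have h := cos_angle_perpTo_mul ha b c
  rw [hprod, hab, hac] at h
  linarith

/-- **`∠ₐ = arccos ((4x − 1)/3)`.** [cite: Hales2012, Lemma 7] -/
theorem apexAngle_isosceles_eq_arccos (ha : ‖a‖ = 1) (hb : ‖b‖ = 1) (hc : ‖c‖ = 1)
    (hab : ⟪a, b⟫ = 1 / 2) (hac : ⟪a, c⟫ = 1 / 2) :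
    angle (perpTo a b) (perpTo a c) = Real.arccos ((4 * ⟪b, c⟫ - 1) / 3) := by
  rw [← cos_apexAngle_isosceles ha hb hc hab hac,
    Real.arccos_cos (angle_nonneg _ _) (angle_le_pi _ _)]

/-- **Lower bound for the apex angle from an upper bound on the base cosine** (`arccos` is
decreasing): `⟪b, c⟫ ≤ t → arccos ((4t − 1)/3) ≤ ∠ₐ`; with `t = κ₀` this is Hales's
`α₄ ≤ ∠ₐ`. [cite: Hales2012, Lemma 7 (α₄)] -/
theorem arccos_le_apexAngle_isosceles (ha : ‖a‖ = 1) (hb : ‖b‖ = 1) (hc : ‖c‖ = 1)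
    (hab : ⟪a, b⟫ = 1 / 2) (hac : ⟪a, c⟫ = 1 / 2) {t : ℝ} (ht : ⟪b, c⟫ ≤ t) :
    Real.arccos ((4 * t - 1) / 3) ≤ angle (perpTo a b) (perpTo a c) := by
  rw [apexAngle_isosceles_eq_arccos ha hb hc hab hac]
  exact Real.arccos_le_arccos (by linarith)

/-- **Upper bound for the apex angle from a lower bound on the base cosine**:
`t ≤ ⟪b, c⟫ → ∠ₐ ≤ arccos ((4t − 1)/3)`; with `t = −1/3` (the Delaunay bound on the base of an
isosceles contact triangle in a facet) this is `∠ₐ ≤ 2α₃`, with `t = 0` (paired bases)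
`∠ₐ ≤ π − α₃`. [cite: Hales2012, Lemma 7] -/
theorem apexAngle_isosceles_le_arccos (ha : ‖a‖ = 1) (hb : ‖b‖ = 1) (hc : ‖c‖ = 1)
    (hab : ⟪a, b⟫ = 1 / 2) (hac : ⟪a, c⟫ = 1 / 2) {t : ℝ} (ht : t ≤ ⟪b, c⟫) :
    angle (perpTo a b) (perpTo a c) ≤ Real.arccos ((4 * t - 1) / 3) := by
  rw [apexAngle_isosceles_eq_arccos ha hb hc hab hac]
  exact Real.arccos_le_arccos (by linarith)

/-- **The base angle of an isosceles contact triangle**: at the base vertex `b`,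
`cos ∠(perpTo b a, perpTo b c) · (√3/2 · ‖perpTo b c‖) = (1 − ⟪b, c⟫)/2`, where
`‖perpTo b c‖ = √(1 − ⟪b, c⟫²)`. [folklore] -/
theorem cos_baseAngle_isosceles_mul (ha : ‖a‖ = 1) (hb : ‖b‖ = 1)
    (hab : ⟪a, b⟫ = 1 / 2) (hac : ⟪a, c⟫ = 1 / 2) :
    Real.cos (angle (perpTo b a) (perpTo b c)) * (Real.sqrt 3 / 2 * ‖perpTo b c‖) =
      (1 - ⟪b, c⟫) / 2 := by
  have hba : ⟪b, a⟫ = 1 / 2 := by rw [real_inner_comm]; exact hab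
  have h := cos_angle_perpTo_mul hb a c
  rw [norm_perpTo_of_inner_eq_half hb ha hba, hac, hba] at h
  linarith

/-- **Squared form**: `cos² ∠_b · 3 (1 − x²) = (1 − x)²` with `x = ⟪b, c⟫` (`c` a unit vector),
i.e. `cos² ∠_b = (1 − x)/(3 (1 + x))` for `x² < 1`. [folklore] -/
theorem cos_baseAngle_isosceles_sq_mul (ha : ‖a‖ = 1) (hb : ‖b‖ = 1) (hc : ‖c‖ = 1)
    (hab : ⟪a, b⟫ = 1 / 2) (hac : ⟪a, c⟫ = 1 / 2) :
    Real.cos (angle (perpTo b a) (perpTo b c)) ^ 2 * (3 * (1 - ⟪b, c⟫ ^ 2)) =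
      (1 - ⟪b, c⟫) ^ 2 := by
  have h := cos_baseAngle_isosceles_mul ha hb hab hac
  have hn : ‖perpTo b c‖ ^ 2 = 1 - ⟪b, c⟫ ^ 2 := norm_perpTo_sq_of_norm_eq_one hb hc
  have h3 : Real.sqrt 3 ^ 2 = 3 := Real.sq_sqrt (by norm_num)
  have hsq : (Real.cos (angle (perpTo b a) (perpTo b c)) * (Real.sqrt 3 / 2 * ‖perpTo b c‖)) ^ 2 =
      ((1 - ⟪b, c⟫) / 2) ^ 2 := by rw [h]
  rw [mul_pow, mul_pow, div_pow, h3, hn] at hsq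
  linear_combination (4 : ℝ) * hsq

/-- **The two base angles are equal** (`∠_b = ∠_c`). [folklore] -/
theorem baseAngle_isosceles_eq (ha : ‖a‖ = 1) (hb : ‖b‖ = 1) (hc : ‖c‖ = 1)
    (hab : ⟪a, b⟫ = 1 / 2) (hac : ⟪a, c⟫ = 1 / 2) :
    angle (perpTo b a) (perpTo b c) = angle (perpTo c a) (perpTo c b) := by
  -- both cosines times the same positive quantity are `(1 − x)/2`
  have hcb : ⟪c, b⟫ = ⟪b, c⟫ := real_inner_comm b c
  have h1 := cos_baseAngle_isosceles_mul ha hb hab hac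
  have h2 := cos_baseAngle_isosceles_mul ha hc hac hab
  rw [hcb, norm_perpTo_comm_of_norm_eq_one hc hb] at h2
  -- if `perpTo b c = 0` then `b = ± c`… but then both angles are angles with the zero vector
  by_cases h0 : ‖perpTo b c‖ = 0
  · have hz1 : perpTo b c = 0 := norm_eq_zero.1 h0
    have hz2 : perpTo c b = 0 := by
      rw [← norm_eq_zero, norm_perpTo_comm_of_norm_eq_one hc hb]; exact h0
    rw [hz1, hz2, angle_zero_right, angle_zero_right]
  · have hpos : 0 < Real.sqrt 3 / 2 * ‖perpTo b c‖ :=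
      mul_pos (by positivity) (lt_of_le_of_ne (norm_nonneg _) (Ne.symm h0))
    have hcos : Real.cos (angle (perpTo b a) (perpTo b c)) =
        Real.cos (angle (perpTo c a) (perpTo c b)) :=
      (mul_left_inj' hpos.ne').1 (h1.trans h2.symm)
    exact injOn_cos ⟨angle_nonneg _ _, angle_le_pi _ _⟩ ⟨angle_nonneg _ _, angle_le_pi _ _⟩ hcos

/-- **The base angles are acute** (`cos ∠_b > 0`) as soon as `b ≠ ± c`
(`⟪b, c⟫² < 1`). [folklore] -/
theorem cos_baseAngle_isosceles_pos (ha : ‖a‖ = 1) (hb : ‖b‖ = 1) (hc : ‖c‖ = 1)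
    (hab : ⟪a, b⟫ = 1 / 2) (hac : ⟪a, c⟫ = 1 / 2) (hx : ⟪b, c⟫ ^ 2 < 1) :
    0 < Real.cos (angle (perpTo b a) (perpTo b c)) := by
  have h := cos_baseAngle_isosceles_mul ha hb hab hac
  have hn : ‖perpTo b c‖ ^ 2 = 1 - ⟪b, c⟫ ^ 2 := norm_perpTo_sq_of_norm_eq_one hb hc
  have hnpos : 0 < ‖perpTo b c‖ := by
    have : 0 < ‖perpTo b c‖ ^ 2 := by rw [hn]; linarith
    exact lt_of_le_of_ne (norm_nonneg _) fun h0 => by rw [← h0] at this; simp at this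
  have hpos : 0 < Real.sqrt 3 / 2 * ‖perpTo b c‖ := mul_pos (by positivity) hnpos
  have hx1 : ⟪b, c⟫ < 1 := (abs_lt.1 ((sq_lt_one_iff_abs_lt_one _).1 hx)).2
  have hrhs : 0 < (1 - ⟪b, c⟫) / 2 := by linarith
  rw [← h] at hrhs
  exact pos_of_mul_pos_left hrhs hpos.le

/-! ### Part B. The base angle as an `arccos` and its monotone bounds -/

/-- **The base angle as an `arccos`**: for `⟪b, c⟫² < 1`,
`cos ∠_b = √((1 − x)/(3 (1 + x)))` with `x = ⟪b, c⟫`. [folklore] -/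
theorem cos_baseAngle_isosceles_eq_sqrt (ha : ‖a‖ = 1) (hb : ‖b‖ = 1) (hc : ‖c‖ = 1)
    (hab : ⟪a, b⟫ = 1 / 2) (hac : ⟪a, c⟫ = 1 / 2) (hx : ⟪b, c⟫ ^ 2 < 1) :
    Real.cos (angle (perpTo b a) (perpTo b c)) = Real.sqrt ((1 - ⟪b, c⟫) / (3 * (1 + ⟪b, c⟫))) := by
  have hpos := cos_baseAngle_isosceles_pos ha hb hc hab hac hx
  have hsq := cos_baseAngle_isosceles_sq_mul ha hb hc hab hac
  have hx1 : -1 < ⟪b, c⟫ := (abs_lt.1 ((sq_lt_one_iff_abs_lt_one _).1 hx)).1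
  have h1x : 0 < 1 + ⟪b, c⟫ := by linarith
  have hx1' : ⟪b, c⟫ < 1 := (abs_lt.1 ((sq_lt_one_iff_abs_lt_one _).1 hx)).2
  have hkey : Real.cos (angle (perpTo b a) (perpTo b c)) ^ 2 * (3 * (1 + ⟪b, c⟫)) = 1 - ⟪b, c⟫ := by
    have hne : (1 - ⟪b, c⟫) ≠ 0 := by linarith
    apply mul_right_cancel₀ hne
    linear_combination hsq
  have hval : Real.cos (angle (perpTo b a) (perpTo b c)) ^ 2 = (1 - ⟪b, c⟫) / (3 * (1 + ⟪b, c⟫)) := by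
    rw [eq_div_iff (by positivity)]
    exact hkey
  rw [← hval, Real.sqrt_sq hpos.le]

/-- **`∠_b = arccos √((1 − x)/(3 (1 + x)))`.** [folklore] -/
theorem baseAngle_isosceles_eq_arccos (ha : ‖a‖ = 1) (hb : ‖b‖ = 1) (hc : ‖c‖ = 1)
    (hab : ⟪a, b⟫ = 1 / 2) (hac : ⟪a, c⟫ = 1 / 2) (hx : ⟪b, c⟫ ^ 2 < 1) :
    angle (perpTo b a) (perpTo b c) = Real.arccos (Real.sqrt ((1 - ⟪b, c⟫) / (3 * (1 + ⟪b, c⟫)))) := by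
  rw [← cos_baseAngle_isosceles_eq_sqrt ha hb hc hab hac hx,
    Real.arccos_cos (angle_nonneg _ _) (angle_le_pi _ _)]

/-- The quantity `(1 − x)/(3 (1 + x))` under the square root is antitone in `x` on `(−1, 1)`.
[folklore] -/
theorem div_three_mul_antitone {x t : ℝ} (hx : -1 < x) (ht : -1 < t) (hxt : x ≤ t) :
    (1 - t) / (3 * (1 + t)) ≤ (1 - x) / (3 * (1 + x)) := by
  rw [div_le_div_iff₀ (by linarith) (by linarith)]
  nlinarith

/-- **Upper bound for the base angle from an upper bound on the base cosine** (`∠_b` increases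
with the base): `⟪b, c⟫ ≤ t → ∠_b ≤ arccos √((1 − t)/(3 (1 + t)))`; with `t = κ₀` this is the
bound `∠_b ≤ 62.07°` of the linear programs. [cite: Hales2012, proof of Lemma 9] -/
theorem baseAngle_isosceles_le_arccos (ha : ‖a‖ = 1) (hb : ‖b‖ = 1) (hc : ‖c‖ = 1)
    (hab : ⟪a, b⟫ = 1 / 2) (hac : ⟪a, c⟫ = 1 / 2) (hx : ⟪b, c⟫ ^ 2 < 1) {t : ℝ}
    (ht : ⟪b, c⟫ ≤ t) :
    angle (perpTo b a) (perpTo b c) ≤ Real.arccos (Real.sqrt ((1 - t) / (3 * (1 + t)))) := by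
  have hx1 : -1 < ⟪b, c⟫ := (abs_lt.1 ((sq_lt_one_iff_abs_lt_one _).1 hx)).1
  rw [baseAngle_isosceles_eq_arccos ha hb hc hab hac hx]
  exact Real.arccos_le_arccos (Real.sqrt_le_sqrt (div_three_mul_antitone hx1 (by linarith) ht))

/-- **Lower bound for the base angle from a lower bound on the base cosine**:
`t ≤ ⟪b, c⟫ → arccos √((1 − t)/(3 (1 + t))) ≤ ∠_b` (`−1 < t`); with `t = −1/3` this is
`∠_b ≥ arccos √(2/3) ≈ 35.26°`, with `t = 0` (paired bases) `∠_b ≥ arccos √(1/3) ≈ 54.7°`.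
[cite: Hales2012, proof of Lemma 9] -/
theorem arccos_le_baseAngle_isosceles (ha : ‖a‖ = 1) (hb : ‖b‖ = 1) (hc : ‖c‖ = 1)
    (hab : ⟪a, b⟫ = 1 / 2) (hac : ⟪a, c⟫ = 1 / 2) (hx : ⟪b, c⟫ ^ 2 < 1) {t : ℝ} (ht1 : -1 < t)
    (ht : t ≤ ⟪b, c⟫) :
    Real.arccos (Real.sqrt ((1 - t) / (3 * (1 + t)))) ≤ angle (perpTo b a) (perpTo b c) := by
  have hx1 : -1 < ⟪b, c⟫ := (abs_lt.1 ((sq_lt_one_iff_abs_lt_one _).1 hx)).1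
  rw [baseAngle_isosceles_eq_arccos ha hb hc hab hac hx]
  exact Real.arccos_le_arccos (Real.sqrt_le_sqrt (div_three_mul_antitone ht1 hx1 ht))

end Isosceles

end Literature.Geometry.DiscreteGeometry

end
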